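import Summits.KontsevichZagierPeriods.KontsevichZagierPeriods.Theorems.RootDecompRelativeModAbsoluteRegFoldingDegOneP06

/-!
# `RegFoldingDegOne` (route `RootDecompRelativeModAbsolute`, support item stmt-KontsevichZagierPeriods-30571) — PROVED · part 7/14

Cell `decomp-kz`, lens 3 (decomp-kz-lens-3 g9): `regFoldingDegOne_holds :
Theses.RootDecompRelativeModAbsolute.RegFoldingDegOne` BY NAME (in part 14/14) — every Kontsevich–Zagier
integral representation on `ℝ²` whose integrand is a quotient `p/q` of `ℚ`-polynomials with `deg_t q ≤ 1`,
`q ≠ 0` on the domain, is equivalent in `KZ.relations` to `[g] + Σᵢ [Uᵢ]`, the `Uᵢ` honest 2-cells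
`[g.domain × (0,1), hᵢ(x) θ^{Mᵢ}/(1 + θ^{eᵢ} κᵢ(x))]` (unfolded REGULARISED log/arctan monomials), with the
fibre integrals matching a.e.  Architecture: §1–§2 regularised terms `RTerm`, `RegFolding d`; §7 a.e.-congruence;
§8 gluing (`FoldsTo`); §9 one-band toolkit; §P analytic core (kernel independence); §10 cylinders; §11 affine band
chart; §13 `RegFolding 1` from a CAD band cover a.e. + vanishing on unbounded bands; last part: the edge to the born
item text and `regFoldingDegOne_holds`.

Source: `HOME/decomp-kz-lens-3/g9/landing/RootDecompRelativeModAbsoluteRegFoldingDegOne.lean` sha256 60038aa44a5f6303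
(4275 l; critic decomp-kz-crit-1 g2 CLEARED/kernel-confirmed 2026-08-30T09:41:19Z, std axioms), split mechanically
into 14 modules ≤ 400 lines by the landing seat decomp-kz-census-1 g7 (contexts re-opened per part; generic docstrings
added where the source had none; parts 1–13 do not import the route file).  No `sorry`; standard axioms.
References: [cite: KontsevichZagier2001, §1.2]; Basu–Pollack–Roy 2006 Def. 5.1 / Cor. 5.7; Bochnak–Coste–Roy 1998 §2.9.
-/

noncomputable section

open Set MeasureTheory Filter Topology
open scoped BigOperators
open Literature.NumberTheory.Transcendental Literature.ModelTheory.ExponentialFields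

namespace Summit.KontsevichZagierPeriods.RootDecompRelativeModAbsolute.Rung30571

namespace RegularisedLogLayer

namespace Plan

section Taylor

variable {d : ℕ}

/-- **`ℓ¹–L¹` comparison for polynomials of degree `≤ d` on an interval `(u,v) ⊆ (0,1)`.** -/
theorem poly_l1_lower_on (d : ℕ) {u v : ℝ} (hu : 0 ≤ u) (huv : u < v) (hv : v ≤ 1) :
    ∃ c : ℝ, 0 < c ∧ ∀ a : Fin (d + 1) → ℝ,
    c * ∑ k, |a k| ≤ ∫ θ in Ioo u v, |∑ k : Fin (d + 1), a k * θ ^ (k : ℕ)| := by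
  set S : Set (Fin (d + 1) → ℝ) := {a | ∑ k, |a k| = 1} with hS
  have hSc : IsCompact S := by
    refine Metric.isCompact_of_isClosed_isBounded ?_ ?_
    · exact isClosed_eq (continuous_finsetSum _ fun k _ => by fun_prop) continuous_const
    · refine (Metric.isBounded_closedBall (x := (0 : Fin (d + 1) → ℝ)) (r := 1)).subset ?_
      intro a ha
      rw [Metric.mem_closedBall, dist_zero_right, pi_norm_le_iff_of_nonneg zero_le_one]
      intro k
      rw [Real.norm_eq_abs, ← ha]
      exact Finset.single_le_sum (f := fun k => |a k|) (fun k _ => abs_nonneg _) (Finset.mem_univ k)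
  have hSne : S.Nonempty := by
    refine ⟨Pi.single 0 1, ?_⟩
    simp only [hS, mem_setOf_eq]
    rw [Finset.sum_eq_single 0]
    · simp
    · intro k _ hk
      simp [hk]
    · simp
  obtain ⟨a₀, ha₀S, hmin⟩ := hSc.exists_isMinOn hSne (continuous_N hu hv).continuousOn
  have ha₀ : a₀ ≠ 0 := by
    intro h
    have : ∑ k, |a₀ k| = 1 := ha₀S
    simp [h] at this
  refine ⟨N u v a₀, N_pos_of_ne_zero huv ha₀, fun a => ?_⟩
  change N u v a₀ * ∑ k, |a k| ≤ N u v a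
  rcases eq_or_lt_of_le (Finset.sum_nonneg fun k (_ : k ∈ Finset.univ) => abs_nonneg (a k))
    with hs | hs
  · rw [← hs, mul_zero]
    exact N_nonneg u v a
  · set s : ℝ := ∑ k, |a k| with hsdef
    have hmem : (fun k => a k / s) ∈ S := by
      simp only [hS, mem_setOf_eq, abs_div, abs_of_pos hs]
      rw [← Finset.sum_div, div_self hs.ne']
    have h1 : N u v a₀ ≤ N u v (fun k => a k / s) := hmin hmem
    rw [N_smul u v a hs] at h1
    exact (le_div_iff₀ hs).1 h1

/-- **`ℓ¹–L¹` comparison for polynomials of degree `≤ d` on `(0,1)`.** -/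
theorem poly_l1_lower (d : ℕ) : ∃ c : ℝ, 0 < c ∧ ∀ a : Fin (d + 1) → ℝ,
    c * ∑ k, |a k| ≤ ∫ θ in Ioo (0 : ℝ) 1, |∑ k : Fin (d + 1), a k * θ ^ (k : ℕ)| :=
  poly_l1_lower_on d le_rfl zero_lt_one le_rfl

/-- **Case B of the endpoint analysis, PROVED for every degree**: `KernelIndependenceTaylor m`. -/
theorem kernelIndependenceTaylor (m : ℕ) : KernelIndependenceTaylor m := by
  obtain ⟨c, hc, hpoly⟩ := poly_l1_lower (m + 1)
  refine ⟨min (1 / 2) (c / 4), by positivity, c / 2, by positivity, fun κ hκ a b => ?_⟩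
  have hκ2 : |κ| ≤ 1 / 2 := hκ.trans (min_le_left _ _)
  have hκc : |κ| ≤ c / 4 := hκ.trans (min_le_right _ _)
  -- the extended coefficient vector `(a₀, …, a_m, b)`
  set a' : Fin (m + 2) → ℝ := Fin.snoc a b with ha'
  have hQ : ∀ θ : ℝ, ∑ k : Fin (m + 2), a' k * θ ^ (k : ℕ) =
      ∑ k : Fin (m + 1), a k * θ ^ (k : ℕ) + b * θ ^ (m + 1) := fun θ => by
    rw [Fin.sum_univ_castSucc]
    simp [ha', Fin.snoc_castSucc, Fin.snoc_last]
  have hsum' : ∑ k : Fin (m + 2), |a' k| = ∑ k : Fin (m + 1), |a k| + |b| := by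
    rw [Fin.sum_univ_castSucc]
    simp [ha', Fin.snoc_castSucc, Fin.snoc_last]
  have hden : ∀ θ ∈ Icc (0 : ℝ) 1, 1 / 2 ≤ 1 + κ * θ := fun θ hθ => by
    have : |κ * θ| ≤ 1 / 2 := by
      rw [abs_mul, abs_of_nonneg hθ.1]
      nlinarith [abs_nonneg κ, hθ.1, hθ.2]
    linarith [neg_abs_le (κ * θ)]
  -- pointwise: `|g θ| ≥ |Q θ| − 2|κ||b|`
  have hpt : ∀ θ ∈ Ioo (0 : ℝ) 1,
      |∑ k : Fin (m + 2), a' k * θ ^ (k : ℕ)| - 2 * |κ| * |b| ≤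
        |∑ k : Fin (m + 1), a k * θ ^ (k : ℕ) + b * θ ^ (m + 1) / (1 + κ * θ)| := by
    intro θ hθ
    have hθ' : θ ∈ Icc (0 : ℝ) 1 := Ioo_subset_Icc_self hθ
    have hd := hden θ hθ'
    have hdpos : 0 < 1 + κ * θ := by linarith
    have hR : |b * θ ^ (m + 1) / (1 + κ * θ) - b * θ ^ (m + 1)| ≤ 2 * |κ| * |b| := by
      have e : b * θ ^ (m + 1) / (1 + κ * θ) - b * θ ^ (m + 1) =
          -(b * κ * θ ^ (m + 2)) / (1 + κ * θ) := by
        field_simp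
        ring
      rw [e, abs_div, abs_neg, abs_of_pos hdpos, div_le_iff₀ hdpos]
      have hθp : θ ^ (m + 2) ≤ 1 := pow_le_one₀ hθ'.1 hθ'.2
      have hθp0 : 0 ≤ θ ^ (m + 2) := pow_nonneg hθ'.1 _
      rw [abs_mul, abs_mul, abs_of_nonneg hθp0]
      nlinarith [abs_nonneg b, abs_nonneg κ, mul_nonneg (abs_nonneg b) (abs_nonneg κ)]
    rw [hQ θ]
    have tri := abs_sub_abs_le_abs_sub
      (∑ k : Fin (m + 1), a k * θ ^ (k : ℕ) + b * θ ^ (m + 1))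
      (∑ k : Fin (m + 1), a k * θ ^ (k : ℕ) + b * θ ^ (m + 1) / (1 + κ * θ))
    have e2 : (∑ k : Fin (m + 1), a k * θ ^ (k : ℕ) + b * θ ^ (m + 1)) -
        (∑ k : Fin (m + 1), a k * θ ^ (k : ℕ) + b * θ ^ (m + 1) / (1 + κ * θ)) =
        -(b * θ ^ (m + 1) / (1 + κ * θ) - b * θ ^ (m + 1)) := by ring
    rw [e2, abs_neg] at tri
    linarith
  -- integrability of both sides on `(0,1)` (continuity on `[0,1]`)
  have hcontg : ContinuousOn
      (fun θ => |∑ k : Fin (m + 1), a k * θ ^ (k : ℕ) + b * θ ^ (m + 1) / (1 + κ * θ)|)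
      (Icc (0 : ℝ) 1) := by
    refine ContinuousOn.abs (ContinuousOn.add (Continuous.continuousOn ?_) ?_)
    · exact continuous_finsetSum _ fun k _ => by fun_prop
    · exact ContinuousOn.div (by fun_prop) (by fun_prop) fun θ hθ => by
        have := hden θ hθ
        linarith
  have hig : IntegrableOn
      (fun θ => |∑ k : Fin (m + 1), a k * θ ^ (k : ℕ) + b * θ ^ (m + 1) / (1 + κ * θ)|)
      (Ioo (0 : ℝ) 1) :=
    (hcontg.integrableOn_Icc (μ := volume)).mono_set Ioo_subset_Icc_self
  have hiP : IntegrableOn (fun θ => |∑ k : Fin (m + 2), a' k * θ ^ (k : ℕ)|) (Ioo (0 : ℝ) 1) :=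
    integrableOn_abs_polyFun 0 1 a'
  have hiC : IntegrableOn (fun _ : ℝ => 2 * |κ| * |b|) (Ioo (0 : ℝ) 1) :=
    (continuousOn_const.integrableOn_Icc (a := (0 : ℝ)) (b := 1)).mono_set Ioo_subset_Icc_self
  have hmono := setIntegral_mono_on (hiP.sub hiC) hig measurableSet_Ioo hpt
  have hvol : (volume : Measure ℝ).real (Ioo (0 : ℝ) 1) = 1 := by
    simp [Measure.real, Real.volume_Ioo]
  rw [integral_sub' hiP hiC, setIntegral_const, hvol, smul_eq_mul, one_mul] at hmono
  have hP := hpoly a'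
  rw [hsum'] at hP
  have hb : 2 * |κ| * |b| ≤ c / 2 * |b| := by nlinarith [abs_nonneg b, abs_nonneg κ]
  have hs0 : 0 ≤ ∑ k : Fin (m + 1), |a k| := Finset.sum_nonneg fun k _ => abs_nonneg _
  change c / 2 * (∑ k : Fin (m + 1), |a k| + |b|) ≤ _
  nlinarith [hmono, hP, hb, hs0, abs_nonneg b]

end Taylor

/-! ## The Away lemma PROVED (cases A, C, D; every degree `m`, every `η > 0`)

Large `κ` (concentration at `θ = 0`): compare the `L¹(½,1)`-part (polynomial dominates, kernel tail
`≤ 1/(2+κ) ≤ (c₁/4)·ℓ₀(κ)` once `log(1+κ) ≥ 4/c₁`) with the whole (`≥ |b|ℓ₀ − Σ|aₖ|`).  `κ → -1`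
(concentration at `θ = 1`): the same with `(0,½)`.  Compact middle: minimum of a continuous positive
function on `[κ₁,κ₂] × {Σ|aₖ| + |b| = 1}` (positivity = `1/(1+κθ)` is not a polynomial, `κ ≠ 0`). -/

section Away

variable {m : ℕ}

/-- `one_add_mul_pos`: auxiliary theorem of the `RegFoldingDegOne` (stmt-30571) development — see the module docstring; statement and proof verbatim from the lens-3 g9 landing file. -/
theorem one_add_mul_pos {κ θ : ℝ} (hκ : -1 < κ) (hθ : θ ∈ Icc (0 : ℝ) 1) : 0 < 1 + κ * θ := by
  rcases le_or_gt 0 κ with h | h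
  · nlinarith [hθ.1]
  · nlinarith [hθ.2]

/-- `one_add_min_le`: auxiliary theorem of the `RegFoldingDegOne` (stmt-30571) development — see the module docstring; statement and proof verbatim from the lens-3 g9 landing file. -/
theorem one_add_min_le {κ θ : ℝ} (hθ : θ ∈ Icc (0 : ℝ) 1) : 1 + min κ 0 ≤ 1 + κ * θ := by
  rcases le_or_gt 0 κ with h | h
  · rw [min_eq_right h]; nlinarith [hθ.1]
  · rw [min_eq_left h.le]; nlinarith [hθ.2]

/-- `continuousOn_ker`: auxiliary theorem of the `RegFoldingDegOne` (stmt-30571) development — see the module docstring; statement and proof verbatim from the lens-3 g9 landing file. -/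
theorem continuousOn_ker {κ : ℝ} (hκ : -1 < κ) :
    ContinuousOn (fun θ : ℝ => 1 / (1 + κ * θ)) (Icc (0 : ℝ) 1) :=
  ContinuousOn.div continuousOn_const (by fun_prop) fun θ hθ => (one_add_mul_pos hκ hθ).ne'

/-- `integrableOn_ker`: auxiliary theorem of the `RegFoldingDegOne` (stmt-30571) development — see the module docstring; statement and proof verbatim from the lens-3 g9 landing file. -/
theorem integrableOn_ker {κ : ℝ} (hκ : -1 < κ) :
    IntegrableOn (fun θ : ℝ => 1 / (1 + κ * θ)) (Ioo (0 : ℝ) 1) :=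
  ((continuousOn_ker hκ).integrableOn_Icc (μ := volume)).mono_set Ioo_subset_Icc_self

/-- `integrableOn_const_Ioo`: auxiliary theorem of the `RegFoldingDegOne` (stmt-30571) development — see the module docstring; statement and proof verbatim from the lens-3 g9 landing file. -/
theorem integrableOn_const_Ioo (u v C : ℝ) : IntegrableOn (fun _ : ℝ => C) (Ioo u v) :=
  (continuousOn_const.integrableOn_Icc (a := u) (b := v) (μ := volume)).mono_set Ioo_subset_Icc_self

/-- `setIntegral_const_Ioo`: auxiliary theorem of the `RegFoldingDegOne` (stmt-30571) development — see the module docstring; statement and proof verbatim from the lens-3 g9 landing file. -/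
theorem setIntegral_const_Ioo {u v : ℝ} (huv : u ≤ v) (C : ℝ) :
    ∫ _ in Ioo u v, C = (v - u) * C := by
  rw [setIntegral_const, smul_eq_mul, measureReal_def, Real.volume_Ioo,
    ENNReal.toReal_ofReal (sub_nonneg.2 huv)]

/-- `ell0_eq`: auxiliary theorem of the `RegFoldingDegOne` (stmt-30571) development — see the module docstring; statement and proof verbatim from the lens-3 g9 landing file. -/
theorem ell0_eq {κ : ℝ} (hκ : -1 < κ) (hκ0 : κ ≠ 0) : ell0 κ = Real.log (1 + κ) / κ := by
  unfold ell0
  rw [← integral_Ioc_eq_integral_Ioo, ← intervalIntegral.integral_of_le zero_le_one]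
  have h := intervalIntegral.integral_comp_mul_add (a := (0 : ℝ)) (b := 1)
    (f := fun x : ℝ => 1 / x) hκ0 1
  simp only [mul_zero, zero_add, mul_one, smul_eq_mul] at h
  have e : ∀ θ : ℝ, 1 / (1 + κ * θ) = 1 / (κ * θ + 1) := fun θ => by rw [add_comm]
  simp_rw [e]
  rw [h, integral_one_div_of_pos one_pos (by linarith), div_one, div_eq_inv_mul, add_comm]

/-- `ell0_nonneg`: auxiliary theorem of the `RegFoldingDegOne` (stmt-30571) development — see the module docstring; statement and proof verbatim from the lens-3 g9 landing file. -/
theorem ell0_nonneg {κ : ℝ} (hκ : -1 < κ) : 0 ≤ ell0 κ :=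
  setIntegral_nonneg measurableSet_Ioo fun _ hθ =>
    (one_div_pos.2 (one_add_mul_pos hκ (Ioo_subset_Icc_self hθ))).le

/-- `ell0_le`: auxiliary theorem of the `RegFoldingDegOne` (stmt-30571) development — see the module docstring; statement and proof verbatim from the lens-3 g9 landing file. -/
theorem ell0_le {κ : ℝ} (hκ : -1 < κ) : ell0 κ ≤ 1 / (1 + min κ 0) := by
  have hpos : 0 < 1 + min κ 0 := by
    have : -1 < min κ 0 := lt_min hκ (by norm_num)
    linarith
  unfold ell0
  calc ∫ θ in Ioo (0 : ℝ) 1, 1 / (1 + κ * θ)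
      ≤ ∫ θ in Ioo (0 : ℝ) 1, 1 / (1 + min κ 0) :=
        setIntegral_mono_on (integrableOn_ker hκ) (integrableOn_const_Ioo 0 1 _) measurableSet_Ioo
          fun θ hθ => one_div_le_one_div_of_le hpos (one_add_min_le (Ioo_subset_Icc_self hθ))
    _ = 1 / (1 + min κ 0) := by rw [setIntegral_const_Ioo zero_le_one]; ring

/-- The order-`0` fibre integrand: polynomial part plus `b/(1+κθ)`. -/
def gFun (κ : ℝ) (a : Fin (m + 1) → ℝ) (b θ : ℝ) : ℝ := polyFun a θ + b / (1 + κ * θ)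

/-- `gFun_smul`: auxiliary theorem of the `RegFoldingDegOne` (stmt-30571) development — see the module docstring; statement and proof verbatim from the lens-3 g9 landing file. -/
theorem gFun_smul (κ : ℝ) (a : Fin (m + 1) → ℝ) (b s θ : ℝ) :
    gFun κ (fun k => a k / s) (b / s) θ = gFun κ a b θ / s := by
  unfold gFun
  rw [polyFun_smul]
  ring

/-- `continuousOn_gFun`: auxiliary theorem of the `RegFoldingDegOne` (stmt-30571) development — see the module docstring; statement and proof verbatim from the lens-3 g9 landing file. -/
theorem continuousOn_gFun {κ : ℝ} (hκ : -1 < κ) (a : Fin (m + 1) → ℝ) (b : ℝ) :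
    ContinuousOn (fun θ => |gFun κ a b θ|) (Icc (0 : ℝ) 1) := by
  refine ContinuousOn.abs ((continuous_polyFun a).continuousOn.add ?_)
  exact ContinuousOn.div continuousOn_const (by fun_prop) fun θ hθ => (one_add_mul_pos hκ hθ).ne'

/-- `integrableOn_gFun`: auxiliary theorem of the `RegFoldingDegOne` (stmt-30571) development — see the module docstring; statement and proof verbatim from the lens-3 g9 landing file. -/
theorem integrableOn_gFun {κ : ℝ} (hκ : -1 < κ) (a : Fin (m + 1) → ℝ) (b : ℝ) :
    IntegrableOn (fun θ => |gFun κ a b θ|) (Ioo (0 : ℝ) 1) :=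
  ((continuousOn_gFun hκ a b).integrableOn_Icc (μ := volume)).mono_set Ioo_subset_Icc_self

/-- `integral_gFun_nonneg`: auxiliary theorem of the `RegFoldingDegOne` (stmt-30571) development — see the module docstring; statement and proof verbatim from the lens-3 g9 landing file. -/
theorem integral_gFun_nonneg (κ : ℝ) (a : Fin (m + 1) → ℝ) (b : ℝ) :
    0 ≤ ∫ θ in Ioo (0 : ℝ) 1, |gFun κ a b θ| :=
  setIntegral_nonneg measurableSet_Ioo fun _ _ => abs_nonneg _

/-- `integral_gFun_smul`: auxiliary theorem of the `RegFoldingDegOne` (stmt-30571) development — see the module docstring; statement and proof verbatim from the lens-3 g9 landing file. -/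
theorem integral_gFun_smul (κ : ℝ) (a : Fin (m + 1) → ℝ) (b : ℝ) {s : ℝ} (hs : 0 < s) :
    ∫ θ in Ioo (0 : ℝ) 1, |gFun κ (fun k => a k / s) (b / s) θ| =
      (∫ θ in Ioo (0 : ℝ) 1, |gFun κ a b θ|) / s := by
  simp_rw [gFun_smul, abs_div, abs_of_pos hs]
  exact MeasureTheory.integral_div _ _

/-- (H3) the kernel part minus the polynomial part. -/
theorem integral_gFun_ge_ker {κ : ℝ} (hκ : -1 < κ) (a : Fin (m + 1) → ℝ) (b : ℝ) :
    |b| * ell0 κ - ∑ k, |a k| ≤ ∫ θ in Ioo (0 : ℝ) 1, |gFun κ a b θ| := by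
  have hpt : ∀ θ ∈ Ioo (0 : ℝ) 1, |b| * (1 / (1 + κ * θ)) - ∑ k, |a k| ≤ |gFun κ a b θ| := by
    intro θ hθ
    have hθ' := Ioo_subset_Icc_self hθ
    have hd := one_add_mul_pos hκ hθ'
    have t := abs_sub_abs_le_abs_sub (b / (1 + κ * θ)) (-(polyFun a θ))
    rw [abs_neg, show b / (1 + κ * θ) - -polyFun a θ = gFun κ a b θ by unfold gFun; ring,
      abs_div, abs_of_pos hd] at t
    have hP := abs_polyFun_le a hθ'
    rw [mul_one_div]
    linarith
  have hik : IntegrableOn (fun θ => |b| * (1 / (1 + κ * θ))) (Ioo (0 : ℝ) 1) :=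
    (integrableOn_ker hκ).const_mul |b|
  have hi1 : IntegrableOn (fun θ => |b| * (1 / (1 + κ * θ)) - ∑ k, |a k|) (Ioo (0 : ℝ) 1) :=
    hik.sub (integrableOn_const_Ioo 0 1 _)
  have hmono := setIntegral_mono_on hi1 (integrableOn_gFun hκ a b) measurableSet_Ioo hpt
  rw [integral_sub hik (integrableOn_const_Ioo 0 1 _), integral_const_mul,
    setIntegral_const_Ioo zero_le_one] at hmono
  unfold ell0
  linarith

/-- (H2) the polynomial part on a window `(u,v)` where the kernel is `≤ K`. -/
theorem integral_gFun_ge_poly {κ : ℝ} (hκ : -1 < κ) (a : Fin (m + 1) → ℝ) (b : ℝ) {u v K : ℝ}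
    (hu : 0 ≤ u) (huv : u ≤ v) (hv : v ≤ 1) (hK : ∀ θ ∈ Ioo u v, 1 / (1 + κ * θ) ≤ K) :
    N u v a - (v - u) * (|b| * K) ≤ ∫ θ in Ioo (0 : ℝ) 1, |gFun κ a b θ| := by
  have hsub : Ioo u v ⊆ Ioo (0 : ℝ) 1 := Ioo_subset_Ioo hu hv
  have hpt : ∀ θ ∈ Ioo u v, |polyFun a θ| - |b| * K ≤ |gFun κ a b θ| := by
    intro θ hθ
    have hθ' : θ ∈ Icc (0 : ℝ) 1 := Ioo_subset_Icc_self (hsub hθ)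
    have hd := one_add_mul_pos hκ hθ'
    have t := abs_sub_abs_le_abs_sub (polyFun a θ) (-(b / (1 + κ * θ)))
    rw [abs_neg, show polyFun a θ - -(b / (1 + κ * θ)) = gFun κ a b θ by unfold gFun; ring,
      abs_div, abs_of_pos hd] at t
    have hk : |b| / (1 + κ * θ) ≤ |b| * K := by
      rw [div_eq_mul_one_div]
      exact mul_le_mul_of_nonneg_left (hK θ hθ) (abs_nonneg b)
    linarith
  have hi1 : IntegrableOn (fun θ => |polyFun a θ| - |b| * K) (Ioo u v) :=
    (integrableOn_abs_polyFun u v a).sub (integrableOn_const_Ioo u v _)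
  have hmono := setIntegral_mono_on hi1 ((integrableOn_gFun hκ a b).mono_set hsub)
    measurableSet_Ioo hpt
  rw [integral_sub (integrableOn_abs_polyFun u v a) (integrableOn_const_Ioo u v _),
    setIntegral_const_Ioo huv] at hmono
  have hmono2 : ∫ θ in Ioo u v, |gFun κ a b θ| ≤ ∫ θ in Ioo (0 : ℝ) 1, |gFun κ a b θ| :=
    setIntegral_mono_set (integrableOn_gFun hκ a b)
      (Eventually.of_forall fun θ => abs_nonneg _) hsub.eventuallyLE
  unfold N
  linarith

/-- the two lower bounds combine to a uniform one. -/
theorem away_algebra {c₁ A B I : ℝ} (hc₁ : 0 ≤ c₁) (hA : 0 ≤ A) (hB : 0 ≤ B)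
    (h1 : c₁ * A - c₁ / 4 * B ≤ I) (h2 : B - A ≤ I) : min (c₁ / 6) (1 / 3) * (A + B) ≤ I := by
  rcases le_or_gt B (2 * A) with h | h
  · calc min (c₁ / 6) (1 / 3) * (A + B) ≤ c₁ / 6 * (A + B) :=
          mul_le_mul_of_nonneg_right (min_le_left _ _) (by linarith)
      _ ≤ I := by nlinarith [mul_nonneg hc₁ (by linarith : (0 : ℝ) ≤ 2 * A - B)]
  · calc min (c₁ / 6) (1 / 3) * (A + B) ≤ 1 / 3 * (A + B) :=
          mul_le_mul_of_nonneg_right (min_le_right _ _) (by linarith)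
      _ ≤ I := by nlinarith

end Away

end Plan

end RegularisedLogLayer

end Summit.KontsevichZagierPeriods.RootDecompRelativeModAbsolute.Rung30571

end
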